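import Summits.Ventures.HodgeRepro2.T6N43TwistRead
import Summits.Ventures.HodgeRepro2.T6N43RuhlHaar

/-!
# T6N43HostRuhl — THEOREM N4.3 on the host-shaped carriers with NO display left: the two Rühl displays
are theorems (T6N43RuhlHaar), the three Eischen–Liu displays are theorems (T6N43TwistRead)

FILED by seat t6-p6 (gen 19, wave 1; staged gen 18 as RS-N4.3 continuation readiness, step 5;
owner file route/T6-N43-t6-p6.md §22).  T6N43RuhlHaar proves `Hyp.Ruhl1970_A2f 𝒟` for every datum on the
carrier `U(1,1)` with the tautological `rep` and a Haar measure; the host-shaped `(1,1)`-places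
`BergmanU11.host` (T6N43HostCarriers) are exactly such data (`μ = haarU11`, `rep = repU11`).  Hence:
* `host_A2f`: the Rühl display holds on every host-shaped `(1,1)`-place;
* `host_archNonvanishing_EL`: THEOREM N4.3 (c) on `BergmanPlaces.host` from the three Eischen–Liu
  displays alone (displays consumed 5 → 3);
* `hostFockRecEL_N43_places_free` / `hostFockRecEL_archNonvanishing_free` /
  `hostFockRecEL_N43_places_withLfac_free`: THEOREM N4.3 (a)–(c) on the lane's candidate `d43` term
  `hostFockRecEL n₁ n₂ n₃` with NO HYPOTHESIS AT ALL (displays consumed 2 → 0).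
COUNT EFFECT on `HCCMOfPublished₂`: none (nothing filed; the displays stay displays in the M2 statement;
on a host inhabitant with `sA.d43 := (hostFockRecEL n₁ n₂ n₃).toPlaces` the binders `hA2f_jA/B` are now
the theorems `host_A2f`).  Axioms: {propext, Classical.choice, Quot.sound}.
§8(d): uses an L-value-free non-vanishing device: NO.
-/

namespace Summit.Ventures.HodgeRepro2.T6

open MeasureTheory N43RuhlHaar

namespace N43Host

/-- **The Rühl display is a THEOREM on every host-shaped `(1,1)`-place**: `haarU11` is a Haar measure of
`U(1,1)` and `repU11` the tautological matrix map, so `T6N43RuhlHaar.ruhl_A2f_of_eq` applies. -/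
theorem host_A2f (c : ℂ) (hc : c ≠ 0) (Lfac : ℂ → ℂ) (τ ν : Fin 1 → ℤ) (r : ℤ) :
    Hyp.Ruhl1970_A2f (BergmanU11.host c hc Lfac τ ν r).datum :=
  ruhl_A2f_of_eq _ haarU11 rfl (fun _ => rfl)

/-- THEOREM N4.3 (c) on the host-shaped bundle from the three Eischen–Liu displays alone (the two Rühl
displays of `host_archNonvanishing` discharged by `host_A2f`). -/
theorem host_archNonvanishing_EL (E : Type) [NormedAddCommGroup E] [InnerProductSpace ℂ E] (m : ℤ)
    (ι : FockPoly →ₗ[ℂ] E) (c₁ : ℂ) (hι : ι Delta ≠ 0) (hc₁ : c₁ ≠ 0) (L₁ : ℂ → ℂ) (τ₁ : Fin 2 → ℤ)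
    (ν₁ : Fin 0 → ℤ) (r₁ : ℤ) (c₂ : ℂ) (hc₂ : c₂ ≠ 0) (L₂ : ℂ → ℂ) (τ₂ ν₂ : Fin 1 → ℤ) (r₂ : ℤ)
    (c₃ : ℂ) (hc₃ : c₃ ≠ 0) (L₃ : ℂ → ℂ) (τ₃ ν₃ : Fin 1 → ℤ) (r₃ : ℤ)
    (hEL₁ : Hyp.EischenLiu2024_Sec2_2 2 0 τ₁ ν₁ r₁ L₁)
    (hEL₂ : Hyp.EischenLiu2024_Sec2_2 1 1 τ₂ ν₂ r₂ L₂)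
    (hEL₃ : Hyp.EischenLiu2024_Sec2_2 1 1 τ₃ ν₃ r₃ L₃) :
    (BergmanPlaces.host E m ι c₁ hι hc₁ L₁ τ₁ ν₁ r₁ c₂ hc₂ L₂ τ₂ ν₂ r₂ c₃ hc₃ L₃ τ₃ ν₃
      r₃).toPlaces.ArchNonvanishing :=
  host_archNonvanishing E m ι c₁ hι hc₁ L₁ τ₁ ν₁ r₁ c₂ hc₂ L₂ τ₂ ν₂ r₂ c₃ hc₃ L₃ τ₃ ν₃ r₃ hEL₁
    (host_A2f c₂ hc₂ L₂ τ₂ ν₂ r₂) hEL₂ (host_A2f c₃ hc₃ L₃ τ₃ ν₃ r₃) hEL₃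

/-- The Rühl display at `τ′₂` of the lane's candidate `d43` term is a theorem. -/
theorem hostFockRecEL_A2f₂ (n₁ n₂ n₃ : ℤ) :
    Hyp.Ruhl1970_A2f (BergmanPlaces.hostFockRecEL n₁ n₂ n₃).toPlaces.d₂ :=
  ruhl_A2f_of_eq _ haarU11 rfl (fun _ => rfl)

/-- The Rühl display at `τ′₃` of the lane's candidate `d43` term is a theorem. -/
theorem hostFockRecEL_A2f₃ (n₁ n₂ n₃ : ℤ) :
    Hyp.Ruhl1970_A2f (BergmanPlaces.hostFockRecEL n₁ n₂ n₃).toPlaces.d₃ :=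
  ruhl_A2f_of_eq _ haarU11 rfl (fun _ => rfl)

/-- **THEOREM N4.3 (a)–(c) on the lane's candidate `d43` term WITH NO HYPOTHESIS**: `Re Z_{τ′_j}(1/2) > 0`
and `Z^*_{τ′_j}(1/2) ≠ 0` at the three real places, for every choice of the datum's odd weights — every
one of the five displays of `N43_places_bergman` is a theorem on this bundle. -/
theorem hostFockRecEL_N43_places_free (n₁ n₂ n₃ : ℤ) :
    (∀ j : Fin 3, 0 < ((BergmanPlaces.hostFockRecEL n₁ n₂ n₃).toPlaces.zetaAt j).re) ∧
      (BergmanPlaces.hostFockRecEL n₁ n₂ n₃).toPlaces.ArchNonvanishing :=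
  hostFockRecEL_N43_places n₁ n₂ n₃ (hostFockRecEL_A2f₂ n₁ n₂ n₃) (hostFockRecEL_A2f₃ n₁ n₂ n₃)

/-- THEOREM N4.3 (c) on the lane's candidate `d43` term with no hypothesis (the conjunct the M2 carrier's
`iA` / `iB` read). -/
theorem hostFockRecEL_archNonvanishing_free (n₁ n₂ n₃ : ℤ) :
    (BergmanPlaces.hostFockRecEL n₁ n₂ n₃).toPlaces.ArchNonvanishing :=
  (hostFockRecEL_N43_places_free n₁ n₂ n₃).2

/-- THEOREM N4.3 on the lane's candidate `d43` term in the re-pointed (NSide / `withLfac`) form the M2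
carrier consumes, with no hypothesis. -/
theorem hostFockRecEL_N43_places_withLfac_free (n₁ n₂ n₃ : ℤ) :
    (∀ j : Fin 3,
        0 < (((BergmanPlaces.hostFockRecEL n₁ n₂ n₃).toPlaces.withLfac (lvArchRead n₁ n₂ n₃)).zetaAt
          j).re) ∧
      ((BergmanPlaces.hostFockRecEL n₁ n₂ n₃).toPlaces.withLfac (lvArchRead n₁ n₂ n₃)).ArchNonvanishing :=
  hostFockRecEL_N43_places_withLfac n₁ n₂ n₃ (hostFockRecEL_A2f₂ n₁ n₂ n₃)
    (hostFockRecEL_A2f₃ n₁ n₂ n₃)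

end N43Host

end Summit.Ventures.HodgeRepro2.T6
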